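import Mathlib.RingTheory.MvPolynomial.Homogeneous
import Mathlib.LinearAlgebra.Matrix.Determinant.Basic
import Literature.Computability.AlgebraicComplexity.DeterminantalComplexity
import HarnessLib

/-!
# Principal-minor (Sylvester / Weinstein–Aronszajn) normal form of affine determinantal expressions

Topic `Literature/Computability/AlgebraicComplexity` (definition item `defn-HasPrincipalMinorRepr`,
wanted by `stmt-ValiantsHypothesis-3775…3783` of route `ValiantsHypothesis/PrincipalMinorColouring`),
next to `HasDetRepr` / `determinantalComplexity` (`DeterminantalComplexity.lean`).

An affine determinantal expression `f = det A`, `A = A₀ + Σ_e x_e A_e` with `A₀ = A(0)`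
invertible, can be rewritten (Weinstein–Aronszajn / matrix determinant lemma, after rank
factorisations `A₀⁻¹A_e = U_e V_eᵀ`) as `f = det A₀ · det(1 + diag(x ∘ κ) K)` for a constant
matrix `K` of size `R = Σ_e rank A_e` and a colouring `κ` repeating the variable `x_e` on
`rank A_e` diagonal places; the coefficient of `x^S` in `det(1 + diag(x∘κ)K)` is the sum of the
principal minors `det K_T` over the `T` on which `κ` is a bijection onto `S`. This is the
"rank-`k` determinantal expression" of Ikenmeyer–Landsberg in coordinates: "**Definition 2.8.**
A polynomial `P(y¹,…,y^M)` admits a rank `k` determinantal expression if there is a determinantal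
expression `P(y) = det(Λ + Σ_j yʲXʲ)` with `rank Xʲ ≤ k`" (arXiv:1610.00159, p. 5; here `Λ = 1`
after normalising by `A₀`, `Xᵉ = diag(1_{κ⁻¹e}) K` of rank `≤ |κ⁻¹e|`), and, with `|κ⁻¹e|`
bounded by `r`, the "read-`k` determinants" of Aravind–Joglekar 2015 (Thm. 1: `perm_m` is not a
read-once determinant over `ℝ`, `m ≥ 5`); for rank one (`κ` injective) it is the principal-minor
polynomial `det(diag(x) + A)` of the principal minor assignment problem (Griffin–Tsatsomeros
2006; Al Ahmadieh–Vinzant 2024; Aravind et al. 2026, §1.3 Step 0).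

## Contents (real definitions; everything stated here is proved)

* `HasPrincipalMinorRepr f R` — `f = C c · det(1 + diag(X ∘ κ) · K)` for some `c : k`,
  `K : Matrix (Fin R) (Fin R) k`, `κ : Fin R → σ` (body verbatim as requested);
  `principalMinorComplexity f = sInf {R | HasPrincipalMinorRepr f R}` (junk `0` if none);
  `HasPrincipalMinorReprRead f r R` — additionally every colour class `κ⁻¹ e` has `≤ r` places.
* API: `hasPrincipalMinorRepr_iff` (unfolding), `HasPrincipalMinorReprRead.hasPrincipalMinorRepr`,
  `constantCoeff_principalMinorDet` (`det(1 + diag(X∘κ)K)` has constant term `1`) and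
  `HasPrincipalMinorRepr.constantCoeff_eq` (`c = f(0)`), `HasPrincipalMinorRepr.hasDetRepr`
  (`R ≥ 1`: absorb `c` into a row, so `dc f ≤ R`), `principalMinorComplexity_le`,
  `HasPrincipalMinorRepr.mono` (monotone in `R`: zero padding, requested API (3)).
* NOT here (requested API (2), (4), to be proved in a companion file): the normal-form theorem
  `IsAffineDetRepr f A ∧ IsUnit (f 0) → HasPrincipalMinorRepr f (Σ_e rank A_e)` (Weinstein–Aronszajn
  with rank factorisations over a field), heredity under specialisation (Schur complement).

## References

* [IkenmeyerLandsberg2017] C. Ikenmeyer, J. M. Landsberg, On the complexity of the permanent in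
  various computational models, J. Pure Appl. Algebra 221 (2017), Def. 2.8, Thm. 2.9, Rem. 2.10.
* [AravindJoglekar2015] N. R. Aravind, P. S. Joglekar, On the expressive power of read-once
  determinants, FCT 2015, Thm. 1 and §5.
* [AravindEtAl2026] A. Aravind et al., Learning read-once determinants and the principal minor
  assignment problem (2026), §1.3.
* [AlahmadiehVinzant2024] A. Al Ahmadieh, C. Vinzant, Determinantal representations and the image
  of the principal minor map, IMRN 2024.
* [GriffinTsatsomeros2006] K. Griffin, M. Tsatsomeros, Principal minors II, LAA 419 (2006).
-/

open MvPolynomial Matrix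

namespace Literature.Computability.AlgebraicComplexity

universe u v

section Defs

variable {k : Type u} [CommRing k] {σ : Type v}

/-- **Principal-minor representation of size `R`:** `f = c · det(1 + diag(x_{κ(1)},…,x_{κ(R)}) · K)`
for a constant `c` (necessarily `c = f(0)`), a constant matrix `K ∈ k^{R×R}` and a colouring
`κ : Fin R → σ` of the diagonal places by variables — a rank-`|κ⁻¹e|` determinantal expression in
the sense of Ikenmeyer–Landsberg with `Λ = 1`, `Xᵉ = diag(1_{κ⁻¹e})K`.
[cite: IkenmeyerLandsberg2017, Def. 2.8] -/
def HasPrincipalMinorRepr (f : MvPolynomial σ k) (R : ℕ) : Prop :=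
  ∃ (c : k) (K : Matrix (Fin R) (Fin R) k) (κ : Fin R → σ),
    f = C c * (1 + Matrix.diagonal (fun i => X (κ i)) * K.map C).det

/-- **Principal-minor complexity:** the least size `R` of a principal-minor representation of `f`
(`sInf`; junk value `0` if there is none — over a field this happens iff `f(0) = 0`; note that
`R = 0` genuinely occurs for constants `f = C c`). [cite: IkenmeyerLandsberg2017, Def. 2.8] -/
noncomputable def principalMinorComplexity (f : MvPolynomial σ k) : ℕ :=
  sInf {R : ℕ | HasPrincipalMinorRepr f R}

/-- **Read-bounded principal-minor representation:** as `HasPrincipalMinorRepr f R`, with every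
variable used on at most `r` diagonal places (`|κ⁻¹e| ≤ r` for all `e`) — for `r = 1` a read-once /
rank-one expression `det(1 + diag(x∘κ)K)`, `κ` injective (Aravind–Joglekar's read-`k`
determinants; the principal-minor polynomial `det(diag(x) + A)`).
[cite: AravindJoglekar2015, Thm. 1 and §5] [cite: IkenmeyerLandsberg2017, Def. 2.8 and Rem. 2.10] -/
def HasPrincipalMinorReprRead [DecidableEq σ] (f : MvPolynomial σ k) (r R : ℕ) : Prop :=
  ∃ (c : k) (K : Matrix (Fin R) (Fin R) k) (κ : Fin R → σ),
    (∀ e, (Finset.univ.filter (fun i => κ i = e)).card ≤ r) ∧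
    f = C c * (1 + Matrix.diagonal (fun i => X (κ i)) * K.map C).det

end Defs

section API

variable {k : Type u} [CommRing k] {σ : Type v}

/-- Unfolding of `HasPrincipalMinorRepr`. [cite: IkenmeyerLandsberg2017, Def. 2.8] -/
theorem hasPrincipalMinorRepr_iff (f : MvPolynomial σ k) (R : ℕ) :
    HasPrincipalMinorRepr f R ↔ ∃ (c : k) (K : Matrix (Fin R) (Fin R) k) (κ : Fin R → σ),
      f = C c * (1 + Matrix.diagonal (fun i => X (κ i)) * K.map C).det :=
  Iff.rfl

/-- A read-bounded representation is a representation. [cite: AravindJoglekar2015, §5] -/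
theorem HasPrincipalMinorReprRead.hasPrincipalMinorRepr [DecidableEq σ] {f : MvPolynomial σ k}
    {r R : ℕ} (h : HasPrincipalMinorReprRead f r R) : HasPrincipalMinorRepr f R := by
  obtain ⟨c, K, κ, -, hf⟩ := h
  exact ⟨c, K, κ, hf⟩

/-- **`det(1 + diag(x∘κ)K)` has constant term `1`** (set `x = 0`). [cite: IkenmeyerLandsberg2017, Def. 2.8] -/
theorem constantCoeff_principalMinorDet {R : ℕ} (K : Matrix (Fin R) (Fin R) k) (κ : Fin R → σ) :
    constantCoeff (1 + Matrix.diagonal (fun i => (X (κ i) : MvPolynomial σ k)) * K.map C).det = 1 := by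
  rw [RingHom.map_det, map_add, map_one, map_mul]
  have h0 : (constantCoeff : MvPolynomial σ k →+* k).mapMatrix
      (Matrix.diagonal fun i => (X (κ i) : MvPolynomial σ k)) = 0 := by
    ext i j
    simp only [RingHom.mapMatrix_apply, Matrix.map_apply, Matrix.diagonal_apply, Matrix.zero_apply]
    split_ifs <;> simp
  rw [h0, zero_mul, add_zero, det_one]

/-- **The constant is the constant term:** in any principal-minor representation
`f = c · det(1 + diag(x∘κ)K)` one has `c = f(0)`. [cite: IkenmeyerLandsberg2017, Def. 2.8] -/
theorem HasPrincipalMinorRepr.constantCoeff_eq {f : MvPolynomial σ k} {R : ℕ} {c : k}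
    {K : Matrix (Fin R) (Fin R) k} {κ : Fin R → σ}
    (hf : f = C c * (1 + Matrix.diagonal (fun i => X (κ i)) * K.map C).det) :
    constantCoeff f = c := by
  rw [hf, map_mul, constantCoeff_C, constantCoeff_principalMinorDet, mul_one]

/-- The entries of `1 + diag(x∘κ)K` are affine linear forms. [cite: IkenmeyerLandsberg2017, Def. 2.8] -/
theorem totalDegree_principalMinorMatrix_le {R : ℕ} (K : Matrix (Fin R) (Fin R) k) (κ : Fin R → σ)
    (i j : Fin R) :
    ((1 + Matrix.diagonal (fun i => (X (κ i) : MvPolynomial σ k)) * K.map C :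
      Matrix (Fin R) (Fin R) (MvPolynomial σ k)) i j).totalDegree ≤ 1 := by
  rw [Matrix.add_apply, Matrix.diagonal_mul, Matrix.map_apply]
  refine (totalDegree_add _ _).trans (max_le ?_ ?_)
  · rw [Matrix.one_apply]
    split_ifs <;> simp
  · refine (totalDegree_mul _ _).trans ?_
    rw [totalDegree_C, add_zero]
    exact (isHomogeneous_X k (κ i)).totalDegree_le

/-- **A principal-minor representation of size `R ≥ 1` is an affine determinantal representation
of size `R`** (multiply the first row by the constant `c`); in particular `dc f ≤ R`.
[cite: IkenmeyerLandsberg2017, Def. 2.8] [cite: MignonRessayre2004, §1] -/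
theorem HasPrincipalMinorRepr.hasDetRepr {f : MvPolynomial σ k} {R : ℕ}
    (h : HasPrincipalMinorRepr f R) (hR : 1 ≤ R) : HasDetRepr f R := by
  obtain ⟨c, K, κ, hf⟩ := h
  set M : Matrix (Fin R) (Fin R) (MvPolynomial σ k) :=
    1 + Matrix.diagonal (fun i => (X (κ i) : MvPolynomial σ k)) * K.map C with hM
  refine ⟨M.updateRow ⟨0, hR⟩ ((C c : MvPolynomial σ k) • M ⟨0, hR⟩), ?_, ?_⟩
  · intro i j
    rw [Matrix.updateRow_apply]
    split_ifs with hi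
    · rw [Pi.smul_apply, smul_eq_mul]
      refine (totalDegree_mul _ _).trans ?_
      rw [totalDegree_C, zero_add]
      exact totalDegree_principalMinorMatrix_le K κ _ j
    · exact totalDegree_principalMinorMatrix_le K κ i j
  · rw [Matrix.det_updateRow_smul, Matrix.updateRow_eq_self, hf]

/-- Hence `dc f ≤ R` for every principal-minor representation of size `R ≥ 1`.
[cite: MignonRessayre2004, §1] -/
theorem HasPrincipalMinorRepr.determinantalComplexity_le {f : MvPolynomial σ k} {R : ℕ}
    (h : HasPrincipalMinorRepr f R) (hR : 1 ≤ R) : determinantalComplexity f ≤ R :=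
  determinantalComplexity_le_of_hasDetRepr (h.hasDetRepr hR)

/-- `principalMinorComplexity f ≤ R` for every principal-minor representation of size `R`.
[cite: IkenmeyerLandsberg2017, Def. 2.8] -/
theorem principalMinorComplexity_le {f : MvPolynomial σ k} {R : ℕ} (h : HasPrincipalMinorRepr f R) :
    principalMinorComplexity f ≤ R :=
  Nat.sInf_le h

/-- Constants have principal-minor representations of size `0` (the empty determinant).
[cite: IkenmeyerLandsberg2017, Def. 2.8] -/
theorem hasPrincipalMinorRepr_C (c : k) [Nonempty σ] : HasPrincipalMinorRepr (C c : MvPolynomial σ k) 0 :=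
  ⟨c, 0, fun i => Fin.elim0 i, by simp⟩

/-- Non-vacuity beyond constants: `1 + xᵢ = det(1 + diag(xᵢ)·(1))` is a read-once principal-minor
representation of size `1`. [cite: AravindJoglekar2015, §5] -/
theorem hasPrincipalMinorRepr_one_add_X (i : σ) : HasPrincipalMinorRepr (1 + X i : MvPolynomial σ k) 1 :=
  ⟨1, 1, fun _ => i, by simp⟩

/-! ### Monotonicity in the size (zero padding) -/

/-- Reindexing a matrix of the shape `1 + diag(v) · K` gives a matrix of the same shape. [folklore] -/
theorem reindex_one_add_diagonal_mul {m : Type*} [Fintype m] [DecidableEq m] {R' : ℕ}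
    (e : m ≃ Fin R') (v : m → MvPolynomial σ k) (K : Matrix m m k) :
    Matrix.reindex e e (1 + Matrix.diagonal v * K.map C) =
      1 + Matrix.diagonal (v ∘ e.symm) * (Matrix.reindex e e K).map C := by
  ext i j
  simp only [Matrix.reindex_apply, Matrix.submatrix_apply, Matrix.add_apply, Matrix.diagonal_mul,
    Matrix.map_apply, Matrix.one_apply, Function.comp_apply, e.symm.injective.eq_iff]

/-- Padding `K` by zero rows and columns: `1 + diag(v, w) · (K ⊕ 0) = (1 + diag(v)K) ⊕ 1`. [folklore] -/
theorem one_add_diagonal_mul_fromBlocks {R d : ℕ} (v : Fin R → MvPolynomial σ k)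
    (w : Fin d → MvPolynomial σ k) (K : Matrix (Fin R) (Fin R) k) :
    (1 + Matrix.diagonal (Sum.elim v w) * (Matrix.fromBlocks K 0 0 (0 : Matrix (Fin d) (Fin d) k)).map C :
        Matrix (Fin R ⊕ Fin d) (Fin R ⊕ Fin d) (MvPolynomial σ k)) =
      Matrix.fromBlocks (1 + Matrix.diagonal v * K.map C) 0 0 1 := by
  ext (a | a) (b | b) <;>
    simp [Matrix.fromBlocks, Matrix.diagonal_mul, Matrix.one_apply, Matrix.add_apply]

/-- **Monotonicity:** a principal-minor representation of size `R` gives one of every size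
`R' ≥ R` (pad `K` by zeros; the new diagonal places carry an arbitrary variable, which does not
occur since its rows of `K` vanish). [cite: IkenmeyerLandsberg2017, Def. 2.8] -/
theorem HasPrincipalMinorRepr.mono [Nonempty σ] {f : MvPolynomial σ k} {R R' : ℕ}
    (h : HasPrincipalMinorRepr f R) (hRR' : R ≤ R') : HasPrincipalMinorRepr f R' := by
  obtain ⟨c, K, κ, hf⟩ := h
  obtain ⟨d, rfl⟩ := Nat.exists_eq_add_of_le hRR'
  obtain ⟨x₀⟩ := ‹Nonempty σ›
  set e : Fin R ⊕ Fin d ≃ Fin (R + d) := finSumFinEquiv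
  refine ⟨c, Matrix.reindex e e (Matrix.fromBlocks K 0 0 0), Sum.elim κ (fun _ ↦ x₀) ∘ e.symm, ?_⟩
  have hshape : (1 + Matrix.diagonal (fun i ↦ (X ((Sum.elim κ (fun _ ↦ x₀) ∘ e.symm) i) : MvPolynomial σ k)) *
      (Matrix.reindex e e (Matrix.fromBlocks K 0 0 (0 : Matrix (Fin d) (Fin d) k))).map C) =
      Matrix.reindex e e (Matrix.fromBlocks (1 + Matrix.diagonal (fun i ↦ X (κ i)) * K.map C) 0 0 1) := by
    have hv : (fun i ↦ (X ((Sum.elim κ (fun _ ↦ x₀) ∘ e.symm) i) : MvPolynomial σ k)) =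
        (Sum.elim (fun i ↦ X (κ i)) (fun _ ↦ X x₀)) ∘ e.symm := by
      funext i
      simp only [Function.comp_apply]
      cases e.symm i <;> rfl
    rw [← one_add_diagonal_mul_fromBlocks (fun i ↦ X (κ i)) (fun _ ↦ X x₀) K, reindex_one_add_diagonal_mul, hv]
  rw [hshape, Matrix.det_reindex_self, Matrix.det_fromBlocks_zero₂₁, det_one, mul_one, hf]

end API

end Literature.Computability.AlgebraicComplexity
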